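import Literature.AlgebraicGeometry.Resolution.HuGammaSchemeResolution
import Literature.Computability.AlgebraicComplexity.DeterminantIrreducible
import Literature.AlgebraicGeometry.Resolution.RegularLocalRingsJacobian
import HarnessLib

/-!
# The quadric cone `(K[y₀,…,y₆] ⧸ (y₃y₆ - y₄y₅))[1/y₀]`: a singular domain (crux `UniversalCells.MatroidCellRes`)

Second of four files exhibiting a witness for the residue stub (N) of crux
stmt-ResolutionOfSingularities-15230 (`UniversalCells.MatroidCellRes`, line `birth`): the target of
the chart computation in `…ResidueWitnessChart.lean`. For a field `K`, the localised hypersurface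
ring `D = (K[y₀,…,y₆] ⧸ (y₃y₆ - y₄y₅))[1/y₀]` is

* a domain (`isDomain_cone`, `isDomain_cone_away`: `y₃y₆ - y₄y₅` is a `2 × 2` determinant of
  distinct variables, prime by `prime_det_of_X`; `y₀ ∉ (y₃y₆ - y₄y₅)`),
* NOT a regular ring (`not_isRegularRing_cone_away`): at the vertex `y = (1, 0, …, 0)` the
  equation and all its partial derivatives vanish, so the local ring there is not regular by the
  Jacobian criterion (`not_isRegularLocalRing_localization_of_pderiv_eval_eq_zero`), and it is a
  localisation of `D` at a prime;

together with three pieces of glue used by the chart computation: constants in `(K[x] ⧸ J)[1/x₀]`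
(`algebraMap_away_mk_C`), extensionality of ring maps out of it (`ringHom_ext_away_mk`) and the
universal property of `D` (`exists_ringHom_cone_away`).

No definition and no notation is declared. Folklore throughout.
-/

noncomputable section

-- single-problem summit: the doubled namespace component `ResolutionOfSingularities` is forced
set_option linter.dupNamespace false

open MvPolynomial Literature.AlgebraicGeometry.Resolution

namespace Summit.ResolutionOfSingularities.ResolutionOfSingularities.Theorems.MatroidCellRes

variable {K : Type} [Field K]

/-! ## The cone ring `K[y₀,…,y₆] ⧸ (y₃y₆ - y₄y₅)` and its localisation at `y₀` -/

/-- `y₃y₆ - y₄y₅` is a prime element of `K[y₀, …, y₆]` (a `2 × 2` determinant of distinct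
variables). [folklore] -/
theorem prime_cone :
    Prime (X 3 * X 6 - X 4 * X 5 : MvPolynomial (Fin 7) K) := by
  have hι : Function.Injective (fun ij : Fin 2 × Fin 2 => (![![(3 : Fin 7), 4], ![5, 6]]) ij.1 ij.2) := by
    decide
  have h := Literature.Computability.AlgebraicComplexity.prime_det_of_X (k := K) hι
  have heq : (Matrix.of fun i j : Fin 2 =>
      (X ((![![(3 : Fin 7), 4], ![5, 6]]) i j) : MvPolynomial (Fin 7) K)).det =
      X 3 * X 6 - X 4 * X 5 := by
    rw [Matrix.det_fin_two]
    simp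
  rw [← heq]
  exact h

/-- The cone ring `K[y] ⧸ (y₃y₆ - y₄y₅)` is a domain. [folklore] -/
theorem isDomain_cone :
    IsDomain (MvPolynomial (Fin 7) K ⧸ Ideal.span {(X 3 * X 6 - X 4 * X 5 : MvPolynomial (Fin 7) K)}) :=
  (Ideal.Quotient.isDomain_iff_prime _).mpr
    ((Ideal.span_singleton_prime prime_cone.ne_zero).mpr prime_cone)

/-- `y₀ ≠ 0` in the cone ring (evaluate at `y = (1, 0, …, 0)`). [folklore] -/
theorem mk_X_zero_ne_zero :
    Ideal.Quotient.mk (Ideal.span {(X 3 * X 6 - X 4 * X 5 : MvPolynomial (Fin 7) K)}) (X 0) ≠ 0 := by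
  intro h
  rw [Ideal.Quotient.eq_zero_iff_mem, Ideal.mem_span_singleton] at h
  obtain ⟨c, hc⟩ := h
  have := congrArg (eval (Pi.single (0 : Fin 7) (1 : K))) hc
  simp [eval_X] at this

/-- The localised cone ring `(K[y] ⧸ (y₃y₆ - y₄y₅))[1/y₀]` is a domain. [folklore] -/
theorem isDomain_cone_away :
    IsDomain (Localization.Away (Ideal.Quotient.mk
      (Ideal.span {(X 3 * X 6 - X 4 * X 5 : MvPolynomial (Fin 7) K)}) (X 0))) := by
  haveI := isDomain_cone (K := K)
  exact IsLocalization.isDomain_localization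
    (powers_le_nonZeroDivisors_of_noZeroDivisors mk_X_zero_ne_zero)

/-! ## The localised cone ring is not regular (Jacobian criterion at the vertex) -/

/-- **The cone chart is singular**: `(K[y] ⧸ (y₃y₆ - y₄y₅))[1/y₀]` is not a regular ring — its
localisation at the point `y = (1, 0, …, 0)` is the localisation of the hypersurface
`y₃y₆ = y₄y₅` at a point where the equation and all its partial derivatives vanish.
[cite: Hartshorne1977, I Thm. 5.1] -/
theorem not_isRegularRing_cone_away :
    ¬ IsRegularRing (Localization.Away (Ideal.Quotient.mk
      (Ideal.span {(X 3 * X 6 - X 4 * X 5 : MvPolynomial (Fin 7) K)}) (X 0))) := by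
  -- names
  set q : MvPolynomial (Fin 7) K := X 3 * X 6 - X 4 * X 5 with hq
  set s : Fin 7 → K := Pi.single 0 1 with hs
  haveI := isDomain_cone (K := K)
  intro hreg
  -- evaluation at the vertex, through the quotient and the localisation
  have hqs : eval s q = 0 := by simp [hq, hs, eval_X]
  have hker : ∀ a ∈ Ideal.span {q}, eval s a = 0 := by
    intro a ha
    rw [Ideal.mem_span_singleton] at ha
    obtain ⟨c, rfl⟩ := ha
    rw [map_mul, hqs, zero_mul]
  set evA : MvPolynomial (Fin 7) K ⧸ Ideal.span {q} →+* K := Ideal.Quotient.lift _ (eval s) hker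
    with hevA
  have hevA_mk : ∀ a, evA (Ideal.Quotient.mk _ a) = eval s a := fun a =>
    Ideal.Quotient.lift_mk _ _ hker
  have hunit : IsUnit (evA (Ideal.Quotient.mk (Ideal.span {q}) (X 0))) := by
    rw [hevA_mk, eval_X, hs]
    simp
  set evD : Localization.Away (Ideal.Quotient.mk (Ideal.span {q}) (X 0)) →+* K :=
    IsLocalization.Away.lift _ hunit with hevD
  -- the point as a prime of the localisation, and its contraction to the cone ring
  haveI hP'prime : (RingHom.ker evD).IsPrime := RingHom.ker_isPrime evD
  haveI hPprime : ((RingHom.ker evD).comap (algebraMap (MvPolynomial (Fin 7) K ⧸ Ideal.span {q})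
      (Localization.Away (Ideal.Quotient.mk (Ideal.span {q}) (X 0))))).IsPrime :=
    Ideal.comap_isPrime _ _
  have hPker : (RingHom.ker evD).comap (algebraMap (MvPolynomial (Fin 7) K ⧸ Ideal.span {q})
      (Localization.Away (Ideal.Quotient.mk (Ideal.span {q}) (X 0)))) = RingHom.ker evA := by
    rw [RingHom.comap_ker]
    congr 1
    refine Ideal.Quotient.ringHom_ext (RingHom.ext fun a => ?_)
    show evD (algebraMap _ _ (Ideal.Quotient.mk _ a)) = evA (Ideal.Quotient.mk _ a)
    rw [hevD, IsLocalization.Away.lift_eq]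
  have hPcomap : ((RingHom.ker evD).comap (algebraMap (MvPolynomial (Fin 7) K ⧸ Ideal.span {q})
      (Localization.Away (Ideal.Quotient.mk (Ideal.span {q}) (X 0))))).comap
        (Ideal.Quotient.mk (Ideal.span {q})) = RingHom.ker (eval s) := by
    rw [hPker, RingHom.comap_ker]
    congr 1
  -- Jacobian criterion at the vertex: the hypersurface local ring is not regular
  have hq0 : q ≠ 0 := prime_cone.ne_zero
  have hpd : ∀ i, eval s (pderiv i q) = 0 := by
    intro i
    fin_cases i <;> simp [hq, hs, eval_X, pderiv_X]
  have hnot := not_isRegularLocalRing_localization_of_pderiv_eval_eq_zero s hq0 hqs hpd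
    ((RingHom.ker evD).comap (algebraMap (MvPolynomial (Fin 7) K ⧸ Ideal.span {q})
      (Localization.Away (Ideal.Quotient.mk (Ideal.span {q}) (X 0))))) hPcomap
  -- but that local ring is a localisation of the regular ring at a prime
  haveI : IsRegularLocalRing (Localization.AtPrime (RingHom.ker evD)) := inferInstance
  have e : Localization.AtPrime (RingHom.ker evD) ≃+*
      Localization.AtPrime ((RingHom.ker evD).comap (algebraMap
        (MvPolynomial (Fin 7) K ⧸ Ideal.span {q})
        (Localization.Away (Ideal.Quotient.mk (Ideal.span {q}) (X 0))))) :=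
    (IsLocalization.localizationLocalizationAtPrimeIsoLocalization
      (Submonoid.powers (Ideal.Quotient.mk (Ideal.span {q}) (X 0)))
      (RingHom.ker evD)).symm.toRingEquiv
  exact hnot (IsRegularLocalRing.of_ringEquiv e)

/-! ## Ring maps out of `(K[x] ⧸ J)[1/x₀]`: constants, extensionality, the cone's universal property -/

/-- Constants in a localised quotient of a polynomial ring. [folklore] -/
theorem algebraMap_away_mk_C {σ : Type*} (J : Ideal (MvPolynomial σ K)) (x : MvPolynomial σ K)
    (r : K) :
    algebraMap K (Localization.Away (Ideal.Quotient.mk J x)) r =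
      algebraMap _ _ (Ideal.Quotient.mk J (C r)) := by
  rw [IsScalarTower.algebraMap_apply K (MvPolynomial σ K ⧸ J) (Localization.Away _),
    ← Ideal.Quotient.mk_algebraMap, MvPolynomial.algebraMap_eq]

/-- Ring maps out of `(K[x] ⧸ J)[1/x₀]` agreeing on the variables and on the constants are equal.
[folklore] -/
theorem ringHom_ext_away_mk {σ : Type*} {T : Type*} [CommRing T] (J : Ideal (MvPolynomial σ K))
    (x : MvPolynomial σ K) {f g : Localization.Away (Ideal.Quotient.mk J x) →+* T}
    (hX : ∀ i, f (algebraMap _ _ (Ideal.Quotient.mk J (X i))) =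
      g (algebraMap _ _ (Ideal.Quotient.mk J (X i))))
    (hC : ∀ r : K, f (algebraMap _ _ (Ideal.Quotient.mk J (C r))) =
      g (algebraMap _ _ (Ideal.Quotient.mk J (C r)))) : f = g :=
  IsLocalization.ringHom_ext (Submonoid.powers (Ideal.Quotient.mk J x))
    (Ideal.Quotient.ringHom_ext (MvPolynomial.ringHom_ext (fun r => hC r) (fun i => hX i)))

/-- **Universal property of the localised cone ring**: a `7`-tuple `g` in a commutative
`K`-algebra with `g₃g₆ = g₄g₅` and `g₀` a unit is the image of `y` under a unique ring map from
`(K[y] ⧸ (y₃y₆ - y₄y₅))[1/y₀]` compatible with constants. [folklore] -/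
theorem exists_ringHom_cone_away {S : Type*} [CommRing S] [Algebra K S] (q : MvPolynomial (Fin 7) K)
    (hq : q = X 3 * X 6 - X 4 * X 5) (g : Fin 7 → S) (hg : g 3 * g 6 - g 4 * g 5 = 0)
    (h0 : IsUnit (g 0)) :
    ∃ ψ : (Localization.Away (Ideal.Quotient.mk (Ideal.span {q}) (X 0))) →+* S,
      (∀ k, ψ (algebraMap _ _ (Ideal.Quotient.mk (Ideal.span {q}) (X k))) = g k) ∧
      (∀ r : K, ψ (algebraMap _ _ (Ideal.Quotient.mk (Ideal.span {q}) (C r))) = algebraMap K S r) ∧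
      g 0 * ψ (IsLocalization.Away.invSelf (Ideal.Quotient.mk (Ideal.span {q}) (X 0))) = 1 := by
  have hq0 : (aeval g : MvPolynomial (Fin 7) K →ₐ[K] S).toRingHom q = 0 := by
    rw [hq, AlgHom.toRingHom_eq_coe, RingHom.coe_coe]
    simp only [map_sub, map_mul, aeval_X]
    exact hg
  have hker : ∀ a ∈ Ideal.span {q}, (aeval g : MvPolynomial (Fin 7) K →ₐ[K] S).toRingHom a = 0 := by
    intro a ha
    rw [Ideal.mem_span_singleton] at ha
    obtain ⟨c, rfl⟩ := ha
    rw [map_mul, hq0, zero_mul]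
  have hmk : ∀ a, Ideal.Quotient.lift _ _ hker (Ideal.Quotient.mk _ a) = aeval g a := fun a =>
    Ideal.Quotient.lift_mk _ _ hker
  have hunit : IsUnit (Ideal.Quotient.lift _ _ hker (Ideal.Quotient.mk (Ideal.span {q}) (X 0))) := by
    rw [hmk, aeval_X]
    exact h0
  refine ⟨IsLocalization.Away.lift _ hunit, fun k => ?_, fun r => ?_, ?_⟩
  · rw [IsLocalization.Away.lift_eq, hmk, aeval_X]
  · rw [IsLocalization.Away.lift_eq, hmk, aeval_C]
  · have h := congrArg (IsLocalization.Away.lift _ hunit)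
      (IsLocalization.Away.mul_invSelf (S := (Localization.Away (Ideal.Quotient.mk (Ideal.span {q}) (X 0)))) (Ideal.Quotient.mk (Ideal.span {q}) (X 0)))
    rw [map_mul, map_one, IsLocalization.Away.lift_eq, hmk, aeval_X] at h
    exact h

end Summit.ResolutionOfSingularities.ResolutionOfSingularities.Theorems.MatroidCellRes

end
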